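import Mathlib
import HarnessLib

/-!
# The `J₃` monomial ideal `K₃`: chart algebra of the stalk action (rung V3, design of record §4)
(crux stmt-ResolutionOfSingularities-15640 `WildQuotients.WildQuotientResolution`, line `Sketch`;
chain w45c rung V3, `L/res-L1-w45c-lead-1/V3-K3-DESIGN.md` §3–§4; [OURS · L1 W4.5c] — NOT a
statement of any manuscript.)

The three-step plain tower resolving `𝔸ⁿ/J₃` in characteristic `3` is ONE blow-up of `𝔸ⁿ` along
`K₃ = (x_a⁴, x_a³x_b, x_a²x_b³, x_a x_b⁴, x_b⁶)`. This file is the pure commutative algebra of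
its five Rees charts, in the abstract form delivered by the chart package
(`TerminalBlowup.stalkAug_of_chartPackage`) and `JordanThree.span_sub_eq_map_sup_span_of_chart`:
a commutative (local) ring `S` (the stalk of the blow-up at a fixed point), elements `Xa, Xb`
(germs of the coordinates), `T` (germ of the chart generator `m_j`, a non-zero-divisor),
`U l` (the chart generators `m_l / m_j`, so `T · U l = m_l(Xa, Xb)`), and a ring endomorphism
`a` (the stalk action of `1 ≠ g ∈ ⟨σ⟩`) with `a Xa = Xa`, `a Xb = Xb + m Xa`, `m` a unit. The
ideal `(Xa, Xb) + (a (U l) - U l : l ≠ j)` — which IS the augmentation ideal of `a` by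
`span_sub_eq_map_sup_span_of_chart` and `JordanThree.span_smul_sub_eq_centre` — is PRINCIPAL on
every chart:

| `j` | `m_j` | ideal | mechanism |
|---|---|---|---|
| 0 | `x_a⁴` | `⊤` | `a t = t + m`, `t = U 1` |
| 1 | `x_a³x_b` | `(u²)`, `u = U 0` | `a u = u/(1+mu)`, `a y = y(1+mu)³ = y(1+m³u³)` (char 3), `y = U 3` |
| 2 | `x_a²x_b³` | `⊤` | `Xb` is a unit (`Xb · U 1 · U 3 = 1`) |
| 3 | `x_a x_b⁴` | `(w²z)`, `w = U 4`, `z = U 1` | `Xb = w²z`; `a w = w(1+mzw)²`, `a z = z(1+mzw)⁻³` (char 3) |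
| 4 | `x_b⁶` | `(Xb)` | `Xa = v Xb²`, `v = U 3`, `a v = v(1+m Xb v)⁻²` |

This file: the helpers and charts `j = 0, 2, 4`; charts `j = 1, 3` (the characteristic-3 ones) are in
`…JordanThreeK3ChartAlgebraCharThree`. All identities are obtained by cancelling non-zero-divisors (`T` and its factors) — no chart-level
description of the lifted automorphism is used. Characteristic `3` enters exactly in charts 1 and 3
(`(1 + x)³ = 1 + x³`); for `p ≥ 5` those two charts give `u·(u, y)` and `wz·(w, z)` (the corner).
-/

-- single-problem summit: the doubled namespace component `ResolutionOfSingularities` is forced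
set_option linter.dupNamespace false

noncomputable section

namespace Summit.ResolutionOfSingularities.ResolutionOfSingularities.Theorems.WildQuotientResolution.JordanThree.K3

universe u

variable {S : Type u} [CommRing S]

/-- Cancel a non-zero-divisor on the left. [folklore] -/
theorem cancel_nzd {t x y : S} (ht : t ∈ nonZeroDivisors S) (h : t * x = t * y) : x = y :=
  (mul_cancel_left_mem_nonZeroDivisors ht).mp h

/-- A factor of a non-zero-divisor is a non-zero-divisor (left factor). [folklore] -/
theorem nzd_of_mul_left {x y : S} (h : x * y ∈ nonZeroDivisors S) : x ∈ nonZeroDivisors S :=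
  (mul_mem_nonZeroDivisors.mp h).1

/-- A factor of a non-zero-divisor is a non-zero-divisor (right factor). [folklore] -/
theorem nzd_of_mul_right {x y : S} (h : x * y ∈ nonZeroDivisors S) : y ∈ nonZeroDivisors S :=
  (mul_mem_nonZeroDivisors.mp h).2

/-- `x ^ (n+1)` non-zero-divisor ⇒ `x` non-zero-divisor. [folklore] -/
theorem nzd_of_pow_succ {x : S} {n : ℕ} (h : x ^ (n + 1) ∈ nonZeroDivisors S) :
    x ∈ nonZeroDivisors S := by
  rw [pow_succ'] at h
  exact nzd_of_mul_left h

/-- The trivial chart generator: `T · U j = T` forces `U j = 1`, so `a (U j) - U j = 0`. [folklore] -/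
theorem sub_self_of_mul_eq {T Uj : S} (hT : T ∈ nonZeroDivisors S) (h : T * Uj = T) (a : S →+* S) :
    a Uj - Uj = 0 := by
  have : Uj = 1 := cancel_nzd hT (by rw [h, mul_one])
  rw [this, map_one, sub_self]

/-- The ideal `(Xa, Xb) + (a (U l) - U l : l ≠ j)` is `⊤` as soon as it contains a unit. [folklore] -/
theorem isPrincipal_of_isUnit_mem {I : Ideal S} {x : S} (hx : x ∈ I) (hu : IsUnit x) :
    I.IsPrincipal := by
  rw [Ideal.eq_top_of_isUnit_mem I hx hu]
  exact ⟨⟨1, by rw [Ideal.submodule_span_eq, Ideal.span_singleton_one]⟩⟩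

section Charts

variable (Xa Xb T m : S) (U : Fin 5 → S) (a : S →+* S)

/-- **Chart 0 (`m_j = x_a⁴`, chart A): the ideal is `⊤`.** `T a(t) = a(x_a³ x_b) = x_a³(x_b + m x_a)
= T (t + m)`, so `a t - t = m` is a unit. [folklore] -/
theorem chart0_isPrincipal (hm : IsUnit m) (haXa : a Xa = Xa) (haXb : a Xb = Xb + m * Xa)
    (hT : T ∈ nonZeroDivisors S) (hT0 : T = Xa ^ 4) (hU1 : T * U 1 = Xa ^ 3 * Xb) :
    (Ideal.span {Xa, Xb} ⊔
      Ideal.span (Set.range fun l : {l : Fin 5 // l ≠ 0} => a (U l) - U l)).IsPrincipal := by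
  have haT : a T = T := by rw [hT0, map_pow, haXa]
  have h1 : T * a (U 1) = T * (U 1 + m) := by
    have h := congrArg a hU1
    rw [map_mul, haT, map_mul, map_pow, haXa, haXb] at h
    rw [h, mul_add, ← hU1, hT0]
    ring
  have h2 : a (U 1) = U 1 + m := cancel_nzd hT h1
  refine isPrincipal_of_isUnit_mem (x := a (U 1) - U 1)
    (Ideal.mem_sup_right (Ideal.subset_span ⟨⟨1, by decide⟩, rfl⟩)) ?_
  rw [h2, add_sub_cancel_left]
  exact hm

/-- **Chart 2 (`m_j = x_a²x_b³`, the torus chart): the ideal is `⊤`.** From `T U₁ = x_a³x_b` and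
`T U₃ = x_a x_b⁴`: `x_b² U₁ = x_a`, `x_a U₃ = x_b`, hence `x_b · (U₁ U₃) = 1` and the ideal
contains the unit `x_b`. [folklore] -/
theorem chart2_isPrincipal (hT : T ∈ nonZeroDivisors S) (hT2 : T = Xa ^ 2 * Xb ^ 3)
    (hU1 : T * U 1 = Xa ^ 3 * Xb) (hU3 : T * U 3 = Xa * Xb ^ 4) :
    (Ideal.span {Xa, Xb} ⊔
      Ideal.span (Set.range fun l : {l : Fin 5 // l ≠ 2} => a (U l) - U l)).IsPrincipal := by
  subst hT2
  have hXa : Xa ∈ nonZeroDivisors S := nzd_of_pow_succ (n := 1) (nzd_of_mul_left hT)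
  have hXb : Xb ∈ nonZeroDivisors S := nzd_of_pow_succ (n := 2) (nzd_of_mul_right hT)
  have hXaXb : Xa * Xb ∈ nonZeroDivisors S := mul_mem hXa hXb
  -- `Xb² U₁ = Xa`
  have h1 : Xb ^ 2 * U 1 = Xa := by
    refine cancel_nzd (mul_mem hXaXb hXa) ?_
    linear_combination hU1
  -- `Xa U₃ = Xb`
  have h3 : Xa * U 3 = Xb := by
    refine cancel_nzd (mul_mem hXaXb (mul_mem hXb hXb)) ?_
    linear_combination hU3
  -- `Xb · (U₁ U₃) = 1`
  have hunit : Xb * (U 1 * U 3) = 1 := by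
    refine cancel_nzd hXb ?_
    linear_combination (U 3) * h1 + h3
  exact isPrincipal_of_isUnit_mem (x := Xb)
    (Ideal.mem_sup_left (Ideal.subset_span (Set.mem_insert_of_mem _ (Set.mem_singleton _))))
    (isUnit_iff_exists_inv.mpr ⟨_, hunit⟩)

/-- Membership in a principal ideal via the quotient map: if `a x ≡ x` and `a y ≡ y` modulo `(τ)`
then `a (x^i y^j) ≡ x^i y^j`. [folklore] -/
theorem sub_mem_of_mk_eq {I : Ideal S} {x y : S} (h : Ideal.Quotient.mk I x = Ideal.Quotient.mk I y) :
    x - y ∈ I := Ideal.Quotient.eq.mp h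

/-- **Chart 4 (`m_j = x_b⁶`, chart B1): the ideal is `(x_b)` — TERMINAL.** `x_a = v x_b²`
(`v = U₃`), the other chart generators are multiples of `x_b`, `a v · (1 + m x_b v)² = v`.
[folklore] -/
theorem chart4_isPrincipal (haXa : a Xa = Xa) (haXb : a Xb = Xb + m * Xa)
    (hT : T ∈ nonZeroDivisors S) (hT4 : T = Xb ^ 6)
    (hU0 : T * U 0 = Xa ^ 4) (hU1 : T * U 1 = Xa ^ 3 * Xb) (hU2 : T * U 2 = Xa ^ 2 * Xb ^ 3)
    (hU3 : T * U 3 = Xa * Xb ^ 4) (hU4 : T * U 4 = Xb ^ 6) :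
    (Ideal.span {Xa, Xb} ⊔
      Ideal.span (Set.range fun l : {l : Fin 5 // l ≠ 4} => a (U l) - U l)).IsPrincipal := by
  subst hT4
  have hXb : Xb ∈ nonZeroDivisors S := nzd_of_pow_succ (n := 5) hT
  -- `Xa = v Xb²`, `v = U 3`
  have hXa : Xa = U 3 * Xb ^ 2 := by
    refine (cancel_nzd (pow_mem hXb 4) ?_).symm
    linear_combination hU3
  -- the other generators
  have h0 : U 0 = U 3 ^ 4 * Xb ^ 2 := by
    refine cancel_nzd hT ?_
    rw [hU0, hXa]; ring
  have h1 : U 1 = U 3 ^ 3 * Xb := by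
    refine cancel_nzd hT ?_
    rw [hU1, hXa]; ring
  have h2 : U 2 = U 3 ^ 2 * Xb := by
    refine cancel_nzd hT ?_
    rw [hU2, hXa]; ring
  have h4 : a (U 4) - U 4 = 0 := sub_self_of_mul_eq hT (by rw [hU4]) a
  -- the action: `a Xb = Xb (1 + m Xb v)`, `a v (1 + m Xb v)² = v`
  have haXb' : a Xb = Xb * (1 + m * Xb * U 3) := by rw [haXb, hXa]; ring
  have hav : a (U 3) * (1 + m * Xb * U 3) ^ 2 = U 3 := by
    refine cancel_nzd (pow_mem hXb 2) ?_
    have h := congrArg a hXa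
    rw [haXa, map_mul, map_pow, haXb'] at h
    linear_combination -h + hXa
  -- the ideal is `(Xb)`
  set I := Ideal.span {Xa, Xb} ⊔
    Ideal.span (Set.range fun l : {l : Fin 5 // l ≠ 4} => a (U l) - U l) with hI
  let K : Ideal S := Ideal.span {Xb}
  have hXbK : Xb ∈ K := Ideal.mem_span_singleton_self _
  have hmk0 : Ideal.Quotient.mk K Xb = 0 := Ideal.Quotient.eq_zero_iff_mem.mpr hXbK
  have hmkv : Ideal.Quotient.mk K (a (U 3)) = Ideal.Quotient.mk K (U 3) := by
    have e : a (U 3) = U 3 - a (U 3) * (m * Xb * U 3) * (2 + m * Xb * U 3) := by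
      linear_combination hav
    rw [e, map_sub, map_mul, map_mul, map_mul, map_mul, hmk0]
    ring
  have hmkXb : Ideal.Quotient.mk K (a Xb) = Ideal.Quotient.mk K Xb := by
    rw [haXb', map_mul, hmk0, zero_mul]
  have key : I = K := by
    apply le_antisymm
    · refine sup_le ?_ ?_
      · rw [Ideal.span_le]
        rintro x hx
        simp only [Set.mem_insert_iff, Set.mem_singleton_iff] at hx
        rcases hx with rfl | rfl
        · exact Ideal.mem_span_singleton'.mpr ⟨U 3 * Xb, by rw [hXa]; ring⟩
        · exact hXbK
      · rw [Ideal.span_le]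
        rintro _ ⟨⟨l, hl⟩, rfl⟩
        change a (U l) - U l ∈ K
        fin_cases l
        · show a (U 0) - U 0 ∈ K
          apply sub_mem_of_mk_eq
          rw [h0, map_mul, map_pow, map_pow, map_mul (Ideal.Quotient.mk K),
            map_pow (Ideal.Quotient.mk K), map_pow (Ideal.Quotient.mk K), hmkv, hmkXb,
            map_mul, map_pow, map_pow]
        · show a (U 1) - U 1 ∈ K
          apply sub_mem_of_mk_eq
          rw [h1, map_mul, map_pow, map_mul (Ideal.Quotient.mk K), map_pow (Ideal.Quotient.mk K),
            hmkv, hmkXb, map_mul, map_pow]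
        · show a (U 2) - U 2 ∈ K
          apply sub_mem_of_mk_eq
          rw [h2, map_mul, map_pow, map_mul (Ideal.Quotient.mk K), map_pow (Ideal.Quotient.mk K),
            hmkv, hmkXb, map_mul, map_pow]
        · show a (U 3) - U 3 ∈ K
          exact sub_mem_of_mk_eq hmkv
        · exact absurd rfl hl
    · exact (Ideal.span_singleton_le_iff_mem _).mpr
        (Ideal.mem_sup_left (Ideal.subset_span (Set.mem_insert_of_mem _ (Set.mem_singleton _))))
  rw [key]
  exact ⟨⟨Xb, rfl⟩⟩

end Charts

end Summit.ResolutionOfSingularities.ResolutionOfSingularities.Theorems.WildQuotientResolution.JordanThree.K3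

end
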